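import Summits.QuantumFields.YangMills.Theorems.BalabanUVNodesN21ExpChartSharpRadius
import Summits.QuantumFields.BalabanUV.T4Continuum.Support.ShellMeasureLogConcaveJacobianSUN

/-!
# N21 (NE7c) · THE SHARP RADIUS `√2·π` OF THE `SU(N)` EXPONENTIAL CHART, IV: the chart's Haar Jacobian `det T_v` is LOG-CONCAVE
# on the OPEN Hilbert–Schmidt ball of radius `√2·π` (Davis–Schur; tree: closed `π`-ball), so the windowed Jacobian weights
# `1_{‖v‖ ≤ S}·J`, `1_{‖x‖ ≤ S}·∏_b J(x_b)` are `IsLogConcaveWeight` for every window radius `S < √2·π`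

Width seat pub-ymgap-dag-n21-w1 (g4; director-ym №197 ∕ HUMAN RULING D-0149), node N21 = NE7c (NOT PRINTED in [Bałaban 1983–89], NOT
proved), lane K3⁸ `SpineGivenEndpointR13SepCoPHV` (stmt-QuantumFields-27366, KEY MAP v2; lineage K3⁷ stmt-QuantumFields-20544),
`--kind proof --supports … --as helper`.  File 26 of the seat's chain — the fourth chart-road input on the maximal window (files 23–25:
injectivity, invertible differential ∕ (CH)₁ ∕ the realized engine, properness, and their failure at `√2·π`).  THEOREMS ONLY: 0 `def`,
0 `sorry`; count-neutral.  Imports file 23 `…N21ExpChartSharpRadius` (§1's gap bound `abs_sub_eigen_lt_two_pi_of_norm_lt`, §5's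
`det_duhT_pos_of_norm_lt`) and pub-balaban's `ShellMeasureLogConcaveJacobianSUN` (hence `ShellMeasureLogConcaveDetSUN`: the root-space profile,
Schur's and Davis's steps on the closed `π`-ball).  NO Theses import.  Restates nothing; cites by name.

WHY.  pub-balaban's Davis–Schur line (`ShellMeasureLogConcaveDetSUN`) proves `log det T_v` concave on `‖v‖ ≤ π`: the root-space profile
`θ ↦ Σ_i Σ_j log sinc((θ_j − θ_i)/2)` is concave on the GAP DOMAIN `{θ | all |θ_j − θ_i| < 2π}` (`concaveOn_logSincSum`), Schur's step
(doubly stochastic frame change + Birkhoff + Jensen) bounds `log det T_v` by the profile of the diagonal in any frame, Davis's step reads the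
eigenvalues of `H(a v₀ + b v₁)` as convex combinations of such diagonals.  The radius `π` enters ONLY to place the angles `θ(v)` in the gap
domain (`abs_sub_eigen_lt_two_pi`).  File 23 §1 places them there for every `‖v‖ < √2·π` — so the whole line re-runs VERBATIM on the open
`√2·π`-ball (convex, hence closed under the convex combinations Davis's step forms), and the member-(λ) packaging
(`ShellMeasureLogConcaveJacobianSUN.isLogConcaveWeight_indicator_jacM`, `S ≤ π`) extends to every window `S < √2·π`.  This is the fourth and
last radius-dependent input of the seat's g2 Jacobian files 11–13 (the Haar Jacobian riding in the REMAINDER of the dressed presentation);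
as for files 23–25, the window radius of the application is a small parameter — this is the SHARPNESS record (at `‖v‖ = √2·π`, file 25:
`det T_v = 0`, so `log det` is not even defined on the closed ball).

WHAT IS PROVED ([folklore]; pub-balaban's modules credited by name, proofs re-run with file 23's gap bound).
* §1 `norm_convexComb_lt` · `log_det_duhT_eq_of_norm_lt` · ★ `logSincSum_diag_ge_of_norm_lt` (Schur's step, ‖v‖ < √2·π).
* §2 ★★ `log_det_duhT_convexComb_ge_of_norm_lt` (Davis's step: `a·log det T_{v₀} + b·log det T_{v₁} ≤ log det T_{a v₀ + b v₁}`,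
  ‖v₀‖, ‖v₁‖ < √2·π) · ★★ `det_duhT_threePoint_of_norm_lt` (`(det T_{v₀})^a (det T_{v₁})^b ≤ det T_{a v₀ + b v₁}`).
* §3 ★ `isLogConcaveWeight_indicator_jacM_of_lt` (`S < √2·π`) · `isLogConcaveWeight_chartWeightSU_jacM_of_lt` ·
  `isLogConcaveWeight_chartWeightSU_smul_jacM_of_lt` — member (λ)'s currency on the full window range.

HONEST FRAMING.  [folklore] matrix analysis BY NAME over pub-balaban's modules; no located letter of any N21 road is touched; types nothing of
Bałaban's; (M1) ∕ NE7c NOT PRINTED ∕ NOT proved; **N21 NOT discharged**; K3⁸ NOT claimed; counts unmoved (typed 28∕28 · discharged 5∕27); never a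
count claim; one finite 𝕋⁴ at fixed ε — R4 would close only the conditional finite-𝕋⁴ rung `BalabanLadder.UV`, NOT the Yang–Mills mass gap (Clay);
nothing about ℝ⁴ ∕ OS.  No decl below carries a cite tag.
-/

set_option autoImplicit false

noncomputable section

open scoped BigOperators ENNReal
open MeasureTheory Set Function Metric Matrix Finset

namespace Summit.QuantumFields.YangMills.Theorems.N21ExpChartSharpRadiusLogConcave

open Literature.MathematicalPhysics.QuantumFieldTheory.Balaban1983to89
open Summit.QuantumFields.BalabanUV.T4Continuum
open Summit.QuantumFields.BalabanUV.T4Continuum.ShellMeasureExpChartSUN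
  (ChartSU BlockChartSU genSU chartWeightSU chartWeightSU_eq_prod_indicator)
open Summit.QuantumFields.BalabanUV.T4Continuum.ShellMeasureVandermondeSUN (conjDiag)
open Summit.QuantumFields.BalabanUV.T4Continuum.ShellMeasureExpJacobianSUN (herm exists_conjDiag)
open Summit.QuantumFields.BalabanUV.T4Continuum.ShellMeasureExpDuhamelSUN (duhT genSU_duhT_eq_integral)
open Summit.QuantumFields.BalabanUV.T4Continuum.ShellMeasureExpDuhamelDetSUN (det_eq_prod_sinc det_mem_Icc)
open Summit.QuantumFields.BalabanUV.T4Continuum.ShellMeasureExpHaarAreaSUN (jacM)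
open Summit.QuantumFields.BalabanUV.T4Continuum.ShellMeasureLogConcave (IsLogConcaveWeight)
open Summit.QuantumFields.BalabanUV.T4Continuum.ShellMeasureLogConcaveDetSUN
  (convex_gapDom comp_perm_mem_gapDom logSincSum_comp_perm concaveOn_logSincSum exp_logSincSum prod_prod_sinc_eq
    star_mul_conjDiag_mul re_conj_diagonal_apply_diag eigen_eq_re_diag re_diag_convexComb)
open Summit.QuantumFields.BalabanUV.T4Continuum.ShellMeasureLogConcaveJacobianSUN
  (jacM_eq_ofReal_det isLogConcaveWeight_pi_prod)
open Summit.QuantumFields.YangMills.Theorems.N21ExpChartSharpRadius (abs_sub_eigen_lt_two_pi_of_norm_lt det_duhT_pos_of_norm_lt)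

variable {N : ℕ}

/-! ## §1 Schur's step on the open `√2·π`-ball -/

section Schur

/-- a convex combination of two points of the OPEN `R`-ball lies in it. [folklore] -/
theorem norm_convexComb_lt {E : Type*} [SeminormedAddCommGroup E] [NormedSpace ℝ E] {x y : E} {R a b : ℝ}
    (hx : ‖x‖ < R) (hy : ‖y‖ < R) (ha : 0 ≤ a) (hb : 0 ≤ b) (hab : a + b = 1) : ‖a • x + b • y‖ < R := by
  have hR : max ‖x‖ ‖y‖ < R := max_lt hx hy
  calc ‖a • x + b • y‖ ≤ ‖a • x‖ + ‖b • y‖ := norm_add_le _ _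
    _ = a * ‖x‖ + b * ‖y‖ := by rw [norm_smul, norm_smul, Real.norm_of_nonneg ha, Real.norm_of_nonneg hb]
    _ ≤ a * max ‖x‖ ‖y‖ + b * max ‖x‖ ‖y‖ :=
        add_le_add (mul_le_mul_of_nonneg_left (le_max_left _ _) ha) (mul_le_mul_of_nonneg_left (le_max_right _ _) hb)
    _ = max ‖x‖ ‖y‖ := by rw [← add_mul, hab, one_mul]
    _ < R := hR

/-- under `H(v) = U₀·diag θ·U₀*` with `‖v‖ < √2·π`: `log det T_v = Σ_i Σ_j log sinc((θ_j − θ_i)/2)` (pub-balaban's `log_det_duhT_eq`,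
`‖v‖ ≤ π`, with file 23's gaps). [folklore] -/
theorem log_det_duhT_eq_of_norm_lt {v : ChartSU N} {U₀ : Matrix.unitaryGroup (Fin N) ℂ} {θ : Fin N → ℝ}
    (h0 : herm v = conjDiag U₀ fun k => (θ k : ℂ)) (hv : ‖v‖ < Real.sqrt 2 * Real.pi) :
    Real.log (LinearMap.det (duhT v : ChartSU N →ₗ[ℝ] ChartSU N)) =
      ∑ i, ∑ j, Real.log (Real.sinc ((θ j - θ i) / 2)) := by
  have hθ : θ ∈ {θ : Fin N → ℝ | ∀ i j, |θ j - θ i| < 2 * Real.pi} :=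
    fun i j => abs_sub_eigen_lt_two_pi_of_norm_lt h0 hv i j
  rw [det_eq_prod_sinc h0 _ (genSU_duhT_eq_integral v), ← prod_prod_sinc_eq, ← exp_logSincSum hθ, Real.log_exp]

/-- ★ **SCHUR'S STEP ON THE OPEN `√2·π`-BALL**: for `‖v‖ < √2·π` and ANY unitary `U` the real diagonal `d_k = Re (U* H(v) U)_{kk}`
lies in the gap domain and its root-space profile dominates `log det T_v` — pub-balaban's `logSincSum_diag_ge` VERBATIM (doubly stochastic
frame change `HoffmanWielandt.normSqEntries_mem_doublyStochastic`, Birkhoff `exists_eq_sum_perm_of_mem_doublyStochastic`, Jensen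
`ConcaveOn.le_map_sum`), with the angles placed in the gap domain by file 23 §1. [folklore] -/
theorem logSincSum_diag_ge_of_norm_lt {v : ChartSU N} (hv : ‖v‖ < Real.sqrt 2 * Real.pi) (U : Matrix.unitaryGroup (Fin N) ℂ) :
    (fun k => ((star (U : Matrix (Fin N) (Fin N) ℂ) * herm v * (U : Matrix (Fin N) (Fin N) ℂ)) k k).re) ∈
        {θ : Fin N → ℝ | ∀ i j, |θ j - θ i| < 2 * Real.pi} ∧
      Real.log (LinearMap.det (duhT v : ChartSU N →ₗ[ℝ] ChartSU N)) ≤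
        ∑ i, ∑ j, Real.log (Real.sinc
          ((((star (U : Matrix (Fin N) (Fin N) ℂ) * herm v * (U : Matrix (Fin N) (Fin N) ℂ)) j j).re -
            ((star (U : Matrix (Fin N) (Fin N) ℂ) * herm v * (U : Matrix (Fin N) (Fin N) ℂ)) i i).re) / 2)) := by
  obtain ⟨U₀, θ, h0⟩ := exists_conjDiag v
  have hθ : θ ∈ {θ : Fin N → ℝ | ∀ i j, |θ j - θ i| < 2 * Real.pi} :=
    fun i j => abs_sub_eigen_lt_two_pi_of_norm_lt h0 hv i j
  -- the frame-change matrix `W = U*U₀` is unitary, so `B = [|w_kl|²]` is doubly stochastic (Schur)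
  set W : Matrix (Fin N) (Fin N) ℂ := star (U : Matrix (Fin N) (Fin N) ℂ) * (U₀ : Matrix (Fin N) (Fin N) ℂ)
  have hWW : Wᴴ * W = 1 := by
    rw [← Matrix.star_eq_conjTranspose]; exact Unitary.coe_star_mul_self (star U * U₀)
  have hWW' : W * Wᴴ = 1 := by
    rw [← Matrix.star_eq_conjTranspose]; exact Unitary.coe_mul_star_self (star U * U₀)
  have hBds := Literature.Analysis.Matrix.HoffmanWielandt.normSqEntries_mem_doublyStochastic hWW hWW'
  set d : Fin N → ℝ :=
    fun k => ((star (U : Matrix (Fin N) (Fin N) ℂ) * herm v * (U : Matrix (Fin N) (Fin N) ℂ)) k k).re with hd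
  have hframe : star (U : Matrix (Fin N) (Fin N) ℂ) * herm v * (U : Matrix (Fin N) (Fin N) ℂ) =
      W * diagonal (fun l => (θ l : ℂ)) * Wᴴ := by
    rw [h0, star_mul_conjDiag_mul]
  have hdB : d = (Matrix.of fun k l => ‖W k l‖ ^ 2 : Matrix (Fin N) (Fin N) ℝ) *ᵥ θ := by
    funext k; simp only [hd, Matrix.mulVec, dotProduct, Matrix.of_apply]; rw [hframe, re_conj_diagonal_apply_diag]
  -- Birkhoff: `B = Σ_σ c_σ P_σ`, so `d = Σ_σ c_σ (θ ∘ σ)`, which lies in the (convex, symmetric) gap domain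
  obtain ⟨c, hc0, hc1, hcB⟩ := exists_eq_sum_perm_of_mem_doublyStochastic hBds
  have hdsum : d = ∑ σ : Equiv.Perm (Fin N), c σ • (θ ∘ σ) := by
    rw [hdB, ← hcB, Matrix.sum_mulVec]
    exact Finset.sum_congr rfl fun σ _ => by rw [Matrix.smul_mulVec, Matrix.permMatrix_mulVec]
  have hmem : d ∈ {θ : Fin N → ℝ | ∀ i j, |θ j - θ i| < 2 * Real.pi} := by
    rw [hdsum]; exact convex_gapDom.sum_mem (fun σ _ => hc0 σ) hc1 (fun σ _ => comp_perm_mem_gapDom hθ σ)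
  refine ⟨hmem, ?_⟩
  -- Jensen + permutation invariance
  change Real.log (LinearMap.det (duhT v : ChartSU N →ₗ[ℝ] ChartSU N)) ≤
    (fun θ : Fin N → ℝ => ∑ i, ∑ j, Real.log (Real.sinc ((θ j - θ i) / 2))) d
  rw [log_det_duhT_eq_of_norm_lt h0 hv, hdsum]
  have hJ := concaveOn_logSincSum.le_map_sum (t := Finset.univ) (w := c) (p := fun σ => θ ∘ σ)
    (fun σ _ => hc0 σ) hc1 (fun σ _ => comp_perm_mem_gapDom hθ σ)
  refine le_trans (le_of_eq ?_) hJ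
  simp only [smul_eq_mul, logSincSum_comp_perm]
  rw [← Finset.sum_mul, hc1, one_mul]

end Schur

/-! ## §2 Davis's step: the three-point inequality on the open `√2·π`-ball -/

section Davis

/-- ★★ **DAVIS'S STEP — `log det T` IS CONCAVE ON THE OPEN `√2·π`-BALL** (two-point form): for `‖v₀‖, ‖v₁‖ < √2·π`, `0 ≤ a, b`,
`a + b = 1`: `a·log det T_{v₀} + b·log det T_{v₁} ≤ log det T_{a v₀ + b v₁}` (pub-balaban's `log_det_duhT_convexComb_ge`, `‖·‖ ≤ π`,
VERBATIM with §1). [folklore] -/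
theorem log_det_duhT_convexComb_ge_of_norm_lt {v₀ v₁ : ChartSU N} (h₀ : ‖v₀‖ < Real.sqrt 2 * Real.pi)
    (h₁ : ‖v₁‖ < Real.sqrt 2 * Real.pi) {a b : ℝ} (ha : 0 ≤ a) (hb : 0 ≤ b) (hab : a + b = 1) :
    a * Real.log (LinearMap.det (duhT v₀ : ChartSU N →ₗ[ℝ] ChartSU N)) +
        b * Real.log (LinearMap.det (duhT v₁ : ChartSU N →ₗ[ℝ] ChartSU N)) ≤
      Real.log (LinearMap.det (duhT (a • v₀ + b • v₁) : ChartSU N →ₗ[ℝ] ChartSU N)) := by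
  have hw : ‖a • v₀ + b • v₁‖ < Real.sqrt 2 * Real.pi := norm_convexComb_lt h₀ h₁ ha hb hab
  obtain ⟨U, θ, h⟩ := exists_conjDiag (a • v₀ + b • v₁)
  obtain ⟨hd₀, hle₀⟩ := logSincSum_diag_ge_of_norm_lt h₀ U
  obtain ⟨hd₁, hle₁⟩ := logSincSum_diag_ge_of_norm_lt h₁ U
  set d₀ : Fin N → ℝ :=
    fun k => ((star (U : Matrix (Fin N) (Fin N) ℂ) * herm v₀ * (U : Matrix (Fin N) (Fin N) ℂ)) k k).re with hd0
  set d₁ : Fin N → ℝ :=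
    fun k => ((star (U : Matrix (Fin N) (Fin N) ℂ) * herm v₁ * (U : Matrix (Fin N) (Fin N) ℂ)) k k).re with hd1
  have hθ : θ = a • d₀ + b • d₁ := by
    funext k; rw [eigen_eq_re_diag h k, re_diag_convexComb]; simp only [hd0, hd1, Pi.add_apply, Pi.smul_apply, smul_eq_mul]
  have hconc := concaveOn_logSincSum.2 hd₀ hd₁ ha hb hab
  simp only [smul_eq_mul] at hconc
  rw [log_det_duhT_eq_of_norm_lt h hw, hθ]
  exact le_trans (add_le_add (mul_le_mul_of_nonneg_left hle₀ ha) (mul_le_mul_of_nonneg_left hle₁ hb)) hconc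

/-- ★★ **THE THREE-POINT INEQUALITY FOR THE `SU(N)` CHART JACOBIAN ON THE OPEN `√2·π`-BALL**:
`(det T_{v₀})^a · (det T_{v₁})^b ≤ det T_{a v₀ + b v₁}` for `‖v₀‖, ‖v₁‖ < √2·π`, `0 ≤ a, b`, `a + b = 1` (exponentiate §2; `det T > 0`
there by file 23's `det_duhT_pos_of_norm_lt`; pub-balaban's `det_duhT_threePoint` is the case `‖·‖ ≤ π`). [folklore] -/
theorem det_duhT_threePoint_of_norm_lt {v₀ v₁ : ChartSU N} (h₀ : ‖v₀‖ < Real.sqrt 2 * Real.pi)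
    (h₁ : ‖v₁‖ < Real.sqrt 2 * Real.pi) {a b : ℝ} (ha : 0 ≤ a) (hb : 0 ≤ b) (hab : a + b = 1) :
    LinearMap.det (duhT v₀ : ChartSU N →ₗ[ℝ] ChartSU N) ^ a *
        LinearMap.det (duhT v₁ : ChartSU N →ₗ[ℝ] ChartSU N) ^ b ≤
      LinearMap.det (duhT (a • v₀ + b • v₁) : ChartSU N →ₗ[ℝ] ChartSU N) := by
  have hp₀ := det_duhT_pos_of_norm_lt h₀
  have hp₁ := det_duhT_pos_of_norm_lt h₁
  have hp := det_duhT_pos_of_norm_lt (norm_convexComb_lt h₀ h₁ ha hb hab)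
  rw [Real.rpow_def_of_pos hp₀, Real.rpow_def_of_pos hp₁, ← Real.exp_add, ← Real.exp_log hp, Real.exp_le_exp,
    mul_comm _ a, mul_comm _ b]
  exact log_det_duhT_convexComb_ge_of_norm_lt h₀ h₁ ha hb hab

end Davis

/-! ## §3 Member (λ)'s currency: the windowed Jacobian weights are `IsLogConcaveWeight` for every `S < √2·π` -/

section Weight

/-- ★ **THE WINDOWED `SU(N)` CHART JACOBIAN `1_{‖v‖ ≤ S}·J` IS A LOG-CONCAVE WEIGHT FOR EVERY `S < √2·π`** (pub-balaban's
`isLogConcaveWeight_indicator_jacM`, `S ≤ π`, VERBATIM with §2). [folklore] -/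
theorem isLogConcaveWeight_indicator_jacM_of_lt {S : ℝ} (hS : S < Real.sqrt 2 * Real.pi) :
    IsLogConcaveWeight ((closedBall (0 : ChartSU N) S).indicator (jacM (N := N))) := by
  intro x y s hs0 hs1
  have h1s : 0 < 1 - s := by linarith
  by_cases hx : x ∈ closedBall (0 : ChartSU N) S
  · by_cases hy : y ∈ closedBall (0 : ChartSU N) S
    · have hz : (1 - s) • x + s • y ∈ closedBall (0 : ChartSU N) S :=
        (convex_closedBall _ _) hx hy h1s.le hs0.le (by ring)
      have hxπ : ‖x‖ < Real.sqrt 2 * Real.pi := (mem_closedBall_zero_iff.mp hx).trans_lt hS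
      have hyπ : ‖y‖ < Real.sqrt 2 * Real.pi := (mem_closedBall_zero_iff.mp hy).trans_lt hS
      rw [indicator_of_mem hx, indicator_of_mem hy, indicator_of_mem hz, jacM_eq_ofReal_det, jacM_eq_ofReal_det,
        jacM_eq_ofReal_det,
        ENNReal.ofReal_rpow_of_nonneg (det_mem_Icc _ (genSU_duhT_eq_integral x)).1 h1s.le,
        ENNReal.ofReal_rpow_of_nonneg (det_mem_Icc _ (genSU_duhT_eq_integral y)).1 hs0.le,
        ← ENNReal.ofReal_mul (Real.rpow_nonneg (det_mem_Icc _ (genSU_duhT_eq_integral x)).1 _)]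
      exact ENNReal.ofReal_le_ofReal (det_duhT_threePoint_of_norm_lt hxπ hyπ h1s.le hs0.le (by ring))
    · rw [indicator_of_notMem hy, ENNReal.zero_rpow_of_pos hs0, mul_zero]
      exact bot_le
  · rw [indicator_of_notMem hx, ENNReal.zero_rpow_of_pos h1s, zero_mul]
    exact bot_le

variable {P : Params} {j : ℕ} (Λ : Finset (PBond P j))

/-- **THE `SU(N)` BLOCK CHART WEIGHT `1_{‖x‖ ≤ S}·∏_b J(x_b)` IS A LOG-CONCAVE WEIGHT** for every `0 ≤ S < √2·π` (pub-balaban's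
`isLogConcaveWeight_chartWeightSU_jacM`, `S ≤ π`). [folklore] -/
theorem isLogConcaveWeight_chartWeightSU_jacM_of_lt {S : ℝ} (hS0 : 0 ≤ S) (hS : S < Real.sqrt 2 * Real.pi) :
    IsLogConcaveWeight (chartWeightSU (N := N) Λ S jacM) := by
  have heq : chartWeightSU (N := N) Λ S jacM =
      fun x : BlockChartSU N Λ => ∏ b, (closedBall (0 : ChartSU N) S).indicator jacM (x b) :=
    funext fun x => chartWeightSU_eq_prod_indicator Λ hS0 jacM x
  rw [heq]
  exact isLogConcaveWeight_pi_prod fun _ => isLogConcaveWeight_indicator_jacM_of_lt hS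

/-- the same for the NORMALISED one-bond weight `κ·J` (e.g. `κ = κ_N` of (CH)₁), `0 ≤ S < √2·π`. [folklore] -/
theorem isLogConcaveWeight_chartWeightSU_smul_jacM_of_lt (κ : ℝ≥0∞) {S : ℝ} (hS0 : 0 ≤ S) (hS : S < Real.sqrt 2 * Real.pi) :
    IsLogConcaveWeight (chartWeightSU (N := N) Λ S fun v => κ * jacM v) := by
  have heq : chartWeightSU (N := N) Λ S (fun v => κ * jacM v) =
      fun x : BlockChartSU N Λ => ∏ b, (closedBall (0 : ChartSU N) S).indicator (fun v => κ * jacM v) (x b) :=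
    funext fun x => chartWeightSU_eq_prod_indicator Λ hS0 _ x
  have hind : (closedBall (0 : ChartSU N) S).indicator (fun v => κ * jacM v) =
      fun v => κ * (closedBall (0 : ChartSU N) S).indicator jacM v := by
    funext v
    by_cases hv : v ∈ closedBall (0 : ChartSU N) S
    · rw [indicator_of_mem hv, indicator_of_mem hv]
    · rw [indicator_of_notMem hv, indicator_of_notMem hv, mul_zero]
  rw [heq, hind]
  exact isLogConcaveWeight_pi_prod fun _ =>
    ShellMeasureLogConcave.isLogConcaveWeight_mul (ShellMeasureLogConcaveJacobianSUN.isLogConcaveWeight_const κ)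
      (isLogConcaveWeight_indicator_jacM_of_lt hS)

end Weight

end Summit.QuantumFields.YangMills.Theorems.N21ExpChartSharpRadiusLogConcave

end
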